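import Literature.NumberTheory.Automorphic.Liu2021.LemD1AsPrintedIndexedNonVacuityTameSynthesis
import HarnessLib

/-!
# [Liu2021, App. D Lemma D.1 (3)] bookkeeping — the det-line carriers WITH THE FACTORISATION `Ψ = θ ∘ det` IN THE TYPE:
# one engine, every source (global norm-one unit ∕ `N` even ∕ wild ∕ inert ∕ split), ANY quadratic `E/F`, every `N ≥ 2`

Reproduction ∕ bookkeeping (Literature, THEOREMS ONLY: no definition, no record, no named fact, no `sorry`; nothing is
asserted about Liu's oscillator representations or about the tree's constructed local Weil carriers).

The existence theorems of ✔ `…DetCarrier` (split places), ✔ `…WildCarrier` (`v_w(N) < 1`), ✔ `…InertCarrier` (global norm-one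
unit; inert places with `gcd(N, q_v + 1) > 1`) and ✔ `…TameSynthesis` print «`∃ Ψ` centre-trivial, locally trivial, `≠ 1`» WITHOUT the
factorisation `Ψ = θ ∘ det` in the type, while the converses ✔ `…InertConverse` ∕ `…RamifiedConverse` ∕ `…TameSynthesis` quantify over
pairs `(Ψ, θ)` with `Ψ g = θ(det g)`.  So «a det-line carrier exists» and «no det-line carrier» were complementary by hypothesis but not
exclusive BY NAME.  THIS FILE re-issues every existence theorem in the converses' currency:

* §1 **`exists_detLine_carrier_of_character`** — THE ENGINE (every place `w ∣ v`, every `N ≥ 2`): a character `θ` of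
  `S.normOne = E_v¹` killing the `N`-th powers, trivial on `{z : z_w ∈ V}` for an open `V ∋ 1` of `E_w`, and `≠ 1`, gives
  `Ψ = θ ∘ det : U(V)(F_v) → ℂˣ` with `Ψ g = θ(det g)` IN THE TYPE, `Ψ ∘ S.scalar = 1` (`det(z · 1_N) = z^N`), `Ψ = 1` on the open
  `{g : det(g)_w ∈ V} ∋ 1`, `Ψ ≠ 1` (`det` is ONTO `E_v¹`, ✔ `…DetCarrier.exists_mem_U_det_eq`), `Ψ^N = 1`, `|Ψ| = 1`.
* §2 **`exists_detLine_carrier_of_norm_one`** — NON-SPLIT `w`, a global `ζ ∈ E` with `ζ c(ζ) = 1`, `v_w(ζ − 1) ≠ 0`,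
  `v_w(ζ^N − 1) < v_w(ζ − 1)` (✔ `…WildCarrier.exists_character_pow_eq_one_of_level`); instances:
  **`exists_detLine_carrier_of_even`** (`N` EVEN, EVERY non-split place, dyadic and ramified included, NO tameness: `ζ = −1`,
  `v_w((−1)^N − 1) = v_w(0) = 0 < v_w(−2)`), **`exists_detLine_carrier_of_wild`** (`v_w(N) < 1`: the global principal norm-one
  unit of ✔ `…WildCarrier`), **`exists_detLine_carrier_of_inert`** (`e(w|v) = 1`, `gcd(N, q_v + 1) > 1`: the inert torsion witness of
  ✔ `…InertFrobenius`), and **`exists_detLine_carrier_of_split`** (`c • w ≠ w`, every `N ≥ 2`: `θ = ν_w ∘ pr_w`, `ν_w = ζ_N^{ord_w}`).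
* §3 consequences for `N` EVEN at EVERY non-split place: the converses' conclusion «every det-factoring centre-trivial `Ψ` is trivial»
  is FALSE (**`not_forall_eq_one_of_factors_through_det_of_even`** — their hypothesis `Odd N` is NECESSARY, for every even `N`, at every
  non-split place of every quadratic `E/F`), and `−1 ∈ E_v¹` is NOT an `N`-th power in `E_v¹` (**`not_exists_pow_eq_neg_one_of_even`**).
* §4 the CM rows (`L` CM, `F = L⁺`, `c` = complex conjugation): the even and the split forms.

What this does NOT give: the decision «carrier ⟺ …» at every place (the sequel `…DetLineDecision`); non-line carriers (characters of
`U(V)(F_v)` not factoring through `det`); the rows' OWN carriers `𝓢.omegaLoc v`; Lem. D.1 itself.  HC_CM is NOT proved.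

Cell pub-hodgecm2 (COR-CM), audit class of the END rows `hD1''` ∕ `hD3`; seat prover-pub-hodgecm2-b10.

References: [Liu2021] Y. Liu, *Fourier–Jacobi cycles and arithmetic relative trace formula*, Camb. J. Math. 9 (2021) =
arXiv:2102.11518, App. D §D.1 (l. 5213–5221), Lemma D.1 (3) (l. 5233); [Mok2014] C. P. Mok, Mem. AMS 235 (2015), §1 Notation p. 5;
[NeukirchANT1999] J. Neukirch, *Algebraic Number Theory* (1999), Ch. II §3 Prop. (3.10), Ch. II §5 Prop. (5.3), Ch. I §9 Exercise 2;
[CasselsFrohlichANT1967] Ch. II §10, Ch. VII §1.1.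
-/

noncomputable section

open scoped Matrix MatrixGroups
open NumberField IsDedekindDomain
open Literature.RepresentationTheory
open Literature.RepresentationTheory.Liu2021 (OscillatorStandingData)
open Literature.NumberTheory.GaloisRepresentations (HeckeCharacter)

namespace Literature.NumberTheory.Automorphic.Liu2021.LemD1IndexedNonVacuityDetLineCarriers

open UnitaryGroup

/-! ## §0 Local helpers (copies of the siblings' private lemmas) -/

section Local

variable {E : Type} [Field E] [NumberField E] (w : HeightOneSpectrum (𝓞 E))

/-- the «level set» `{y : v_w(y − 1) < v_w(t)}` is open in `E_w`. [cite: NeukirchANT1999, Ch. II §3, before Prop. (3.10)] -/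
private theorem isOpen_setOf_valued_sub_one_lt (t : w.adicCompletion E) :
    IsOpen {y : w.adicCompletion E | Valued.v (y - 1) < Valued.v t} := by
  have h := (Valued.isOpen_ball (w.adicCompletion E) (Valued.v.restrict t)).preimage
    (show Continuous fun y : w.adicCompletion E => y - 1 from continuous_id.sub continuous_const)
  convert h using 1
  ext y
  simp only [Set.mem_setOf_eq, Set.mem_preimage, Valuation.restrict_lt_iff]

/-- `{y : v_w(y) = 1}` is open in `E_w` (the valuation is locally constant off `0`). [folklore] -/
private theorem isOpen_setOf_valued_eq_one : IsOpen {y : w.adicCompletion E | Valued.v y = 1} := by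
  refine isOpen_iff_mem_nhds.2 fun y hy => ?_
  rw [Set.mem_setOf_eq] at hy
  have h := Valued.locally_const (x := y) (by rw [hy]; exact one_ne_zero)
  simpa only [hy] using h

/-- **the unramified character `ν_w = ζ_N^{ord_w}` of `E_wˣ` of order dividing `N`** (`ζ_N = e^{2πi/N}`, `N ≥ 2`): trivial on the
units of valuation `1`, `ν^N = 1`, and `ν(x) ≠ 1` whenever `v_w(x) = exp(−1)` (copy of the private lemma of `…DetCarrier` §3). [folklore] -/
private theorem exists_unramified_character {N : ℕ} (hN : 2 ≤ N) :
    ∃ ν : (w.adicCompletion E)ˣ →* ℂˣ,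
      (∀ x : (w.adicCompletion E)ˣ, Valued.v (x : w.adicCompletion E) = 1 → ν x = 1) ∧
      (∀ x, ν x ^ N = 1) ∧
      ∀ x : (w.adicCompletion E)ˣ, Valued.v (x : w.adicCompletion E) = WithZero.exp (-1 : ℤ) → ν x ≠ 1 := by
  have hN0 : N ≠ 0 := by omega
  have hprim : IsPrimitiveRoot (Complex.exp (2 * Real.pi * Complex.I / (N : ℕ))) N := Complex.isPrimitiveRoot_exp N hN0
  set ζ : ℂˣ := (hprim.isUnit hN0).unit with hζdef
  have hζval : (ζ : ℂ) = Complex.exp (2 * Real.pi * Complex.I / (N : ℕ)) := (hprim.isUnit hN0).unit_spec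
  have hζ : IsPrimitiveRoot ζ N := IsPrimitiveRoot.coe_units_iff.1 (by rw [hζval]; exact hprim)
  have hζN : ζ ^ N = 1 := hζ.pow_eq_one
  have hζne : ζ ≠ 1 := hζ.ne_one (by omega)
  set f : Multiplicative ℤ →* ℂ := (Units.coeHom ℂ).comp (zpowersHom ℂˣ ζ) with hfdef
  set ν₀ : w.adicCompletion E →*₀ ℂ :=
    (WithZero.lift' f).comp (Valued.v : Valuation (w.adicCompletion E) (WithZero (Multiplicative ℤ))).toMonoidWithZeroHom
    with hν₀def
  have hν₀ : ∀ x : w.adicCompletion E, x ≠ 0 → ν₀ x = ((ζ ^ WithZero.log (Valued.v x) : ℂˣ) : ℂ) := by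
    intro x hx
    have hvx : Valued.v x ≠ 0 := (Valuation.ne_zero_iff _).2 hx
    rw [hν₀def, MonoidWithZeroHom.comp_apply]
    change WithZero.lift' f (Valued.v x) = _
    conv_lhs => rw [← WithZero.exp_log hvx]
    rw [show WithZero.exp (WithZero.log (Valued.v x)) =
        ((Multiplicative.ofAdd (WithZero.log (Valued.v x)) : Multiplicative ℤ) : WithZero (Multiplicative ℤ)) from rfl,
      WithZero.lift'_coe, hfdef, MonoidHom.comp_apply, zpowersHom_apply, Units.coeHom_apply]
    rfl
  set ν : (w.adicCompletion E)ˣ →* ℂˣ := Units.map ν₀.toMonoidHom with hνdef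
  have hν : ∀ x : (w.adicCompletion E)ˣ, ν x = ζ ^ WithZero.log (Valued.v (x : w.adicCompletion E)) := by
    intro x
    apply Units.ext
    rw [hνdef, Units.coe_map]
    exact hν₀ x x.ne_zero
  refine ⟨ν, fun x hx => ?_, fun x => ?_, fun x hx => ?_⟩
  · rw [hν, hx, WithZero.log_one, zpow_zero]
  · rw [hν, ← zpow_natCast, ← zpow_mul, mul_comm, zpow_mul, zpow_natCast, hζN, one_zpow]
  · rw [hν, hx, WithZero.log_exp, zpow_neg, zpow_one, Ne, inv_eq_one]
    exact hζne

/-- transport of ✔ `…WildCarrier.valued_pow_sub_one_lt` to a GLOBAL element: `v_w(N) < 1`, `0 ≠ v_w(a − 1) < 1` give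
`v_w(a^N − 1) < v_w(a − 1)`. [cite: NeukirchANT1999, Ch. II §3 Prop. (3.10)] -/
private theorem valuation_pow_sub_one_lt {N : ℕ} (hwN : Valued.v ((N : w.adicCompletion E)) < 1) {a : E}
    (ha0 : w.valuation E (a - 1) ≠ 0) (ha1 : w.valuation E (a - 1) < 1) :
    w.valuation E (a ^ N - 1) < w.valuation E (a - 1) := by
  have h1 : ((a : E) : w.adicCompletion E) - 1 = ((a - 1 : E) : w.adicCompletion E) := by
    change algebraMap E (w.adicCompletion E) a - 1 = algebraMap E (w.adicCompletion E) (a - 1)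
    rw [map_sub, map_one]
  have hN : ((a : E) : w.adicCompletion E) ^ N - 1 = ((a ^ N - 1 : E) : w.adicCompletion E) := by
    change algebraMap E (w.adicCompletion E) a ^ N - 1 = algebraMap E (w.adicCompletion E) (a ^ N - 1)
    rw [map_sub, map_pow, map_one]
  have hv1 : Valued.v (((a : E) : w.adicCompletion E) - 1) = w.valuation E (a - 1) := by
    rw [h1, HeightOneSpectrum.valuedAdicCompletion_eq_valuation']
  have hvN : Valued.v (((a : E) : w.adicCompletion E) ^ N - 1) = w.valuation E (a ^ N - 1) := by
    rw [hN, HeightOneSpectrum.valuedAdicCompletion_eq_valuation']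
  rw [← hv1, ← hvN]
  exact LemD1IndexedNonVacuityWildCarrier.valued_pow_sub_one_lt w hwN (by rw [hv1]; exact ha0) (by rw [hv1]; exact ha1)

end Local

/-! ## §1 THE ENGINE: a character `θ` of `E_v¹` killing the `N`-th powers gives the det-line carrier `Ψ = θ ∘ det` -/

section PlaceModel

variable {F : Type} (E : Type) [Field F] [NumberField F] [Field E] [NumberField E] [Algebra F E]
  [Algebra.IsQuadraticExtension F E] (v : HeightOneSpectrum (𝓞 F)) (c : E ≃ₐ[F] E)
  {δ : E} (hcδ : c δ = -δ) (hδ : δ ≠ 0)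
  (N : ℕ) (J : Matrix (Fin N) (Fin N) E) (hN : 2 ≤ N) (hJh : (J.map c)ᵀ = J) (hJdet : J.det ≠ 0)

omit [NumberField F] [Algebra.IsQuadraticExtension F E] in
include hcδ hδ in
/-- `c ≠ 1` (`c δ = −δ ≠ δ`); copy of the siblings' private lemma. [folklore] -/
private theorem hc_of_delta : c ≠ 1 := by
  rintro rfl
  rw [AlgEquiv.one_apply] at hcδ
  have h2 : (2 : E) * δ = 0 := by linear_combination hcδ
  exact hδ ((mul_eq_zero.mp h2).resolve_left two_ne_zero)

include hcδ hδ in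
/-- at a NON-SPLIT place `w` (`c • w = w`), norm-one elements are `w`-units (`v_w(z_w)² = 1`); copy of the siblings' private lemma.
[cite: CasselsFrohlichANT1967, Ch. VII §1.1] -/
private theorem valued_apply_eq_one_of_mem_normOne (w : PlacesOver E v) (hw : c • w.1 = w.1)
    (z : (LemD1OfPlace.standingData E v c N J hcδ hδ hN hJh hJdet).normOne) :
    Valued.v ((((z : (LocalRing E v)ˣ) : LocalRing E v)) w) = 1 := by
  have h := LemD1IndexedNonVacuityInertRigidity.valued_mul_conjLocal_apply E v c hcδ hδ w hw ((z : (LocalRing E v)ˣ) : LocalRing E v)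
  rw [LemD1OfPlace.mul_conjLocal_eq_one E v c N J hcδ hδ hN hJh hJdet z, Pi.one_apply, map_one] at h
  exact (pow_eq_one_iff_left two_ne_zero).1 h.symm

/-- determinants of `U(V)(F_v)` are norm-one (`(gᶜ)ᵀ (J ⊗ 1) g = J ⊗ 1`, `det (J ⊗ 1)` a unit); copy of the siblings' private lemma.
[cite: Liu2021, App. D §D.1 (l. 5213)] [cite: Mok2014, §1 Notation p. 5] -/
private theorem det_mem_normOne (g : (LemD1OfPlace.standingData E v c N J hcδ hδ hN hJh hJdet).U) :
    Matrix.GeneralLinearGroup.det (g : GL (Fin N) (LocalRing E v)) ∈ (LemD1OfPlace.standingData E v c N J hcδ hδ hN hJh hJdet).normOne := by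
  let S := LemD1OfPlace.standingData E v c N J hcδ hδ hN hJh hJdet
  rw [OscillatorStandingData.mem_normOne_iff', Matrix.GeneralLinearGroup.val_det_apply]
  have hg := (OscillatorStandingData.mem_U_iff S _).1 g.2
  have h := congrArg Matrix.det hg
  rw [Matrix.det_mul, Matrix.det_mul, Matrix.det_transpose] at h
  have hc : (((g : GL (Fin N) (LocalRing E v)) : Matrix (Fin N) (Fin N) (LocalRing E v)).map S.conj).det =
      S.conj (((g : GL (Fin N) (LocalRing E v)) : Matrix (Fin N) (Fin N) (LocalRing E v)).det) := by
    rw [AlgEquiv.map_det, AlgEquiv.mapMatrix_apply]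
  rw [hc] at h
  have h2 : (((g : GL (Fin N) (LocalRing E v)) : Matrix (Fin N) (Fin N) (LocalRing E v)).det *
      S.conj (((g : GL (Fin N) (LocalRing E v)) : Matrix (Fin N) (Fin N) (LocalRing E v)).det) - 1) * S.gram.det = 0 := by
    linear_combination h
  exact sub_eq_zero.1 ((S.isUnit_det_gram.mul_left_eq_zero).1 h2)

/-- `det (z · 1_N) = z^N` in `E_v¹`. [cite: Liu2021, App. D §D.1 Step 3 (l. 5221)] -/
private theorem det_scalar (z : (LemD1OfPlace.standingData E v c N J hcδ hδ hN hJh hJdet).normOne) :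
    (⟨Matrix.GeneralLinearGroup.det (((LemD1OfPlace.standingData E v c N J hcδ hδ hN hJh hJdet).scalar z :
        (LemD1OfPlace.standingData E v c N J hcδ hδ hN hJh hJdet).U) : GL (Fin N) (LocalRing E v)),
      det_mem_normOne E v c hcδ hδ N J hN hJh hJdet ((LemD1OfPlace.standingData E v c N J hcδ hδ hN hJh hJdet).scalar z)⟩ :
      (LemD1OfPlace.standingData E v c N J hcδ hδ hN hJh hJdet).normOne) = z ^ N := by
  apply Subtype.ext
  rw [SubgroupClass.coe_pow]
  apply Units.ext
  rw [Matrix.GeneralLinearGroup.val_det_apply, OscillatorStandingData.coe_scalar, Matrix.scalar_apply, Matrix.det_diagonal,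
    Finset.prod_const, Finset.card_univ, Fintype.card_fin, Units.val_pow_eq_pow_val]

include hcδ in
/-- **THE ENGINE.**  At ANY place `w ∣ v` and for ANY `N ≥ 2`: let `θ` be a character of `S.normOne = E_v¹` that kills the `N`-th
powers (`θ(z^N) = 1`), is trivial on `{z : z_w ∈ V}` for some open `V ∋ 1` of `E_w`, and is non-trivial.  Then `Ψ := θ ∘ det` is a
character of `U(V)(F_v) = S.U` with — IN THE TYPE — `Ψ g = θ(det g)`, `Ψ ∘ S.scalar = 1` (`det(z · 1_N) = z^N`), `Ψ = 1` on the open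
neighbourhood `{g : det(g)_w ∈ V}` of `1`, `Ψ(g₀) ≠ 1` for some `g₀` (`det : U(V)(F_v) → E_v¹` is ONTO, ✔ `…DetCarrier.exists_mem_U_det_eq`),
`Ψ^N = 1` and `|Ψ| = 1`. [cite: Liu2021, App. D §D.1 Step 3 (l. 5221)] [cite: Mok2014, §1 Notation p. 5] -/
theorem exists_detLine_carrier_of_character (w : PlacesOver E v)
    (θ : (LemD1OfPlace.standingData E v c N J hcδ hδ hN hJh hJdet).normOne →* ℂˣ)
    (hθN : ∀ z, θ (z ^ N) = 1)
    (V : Set (w.1.adicCompletion E)) (hV : IsOpen V) (h1V : (1 : w.1.adicCompletion E) ∈ V)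
    (hθV : ∀ z : (LemD1OfPlace.standingData E v c N J hcδ hδ hN hJh hJdet).normOne,
      (((z : (LocalRing E v)ˣ) : LocalRing E v)) w ∈ V → θ z = 1)
    (hθne : ∃ z, θ z ≠ 1) :
    ∃ (Ψ : (LemD1OfPlace.standingData E v c N J hcδ hδ hN hJh hJdet).U →* ℂˣ),
      (∀ (g : (LemD1OfPlace.standingData E v c N J hcδ hδ hN hJh hJdet).U)
        (hg : Matrix.GeneralLinearGroup.det (g : GL (Fin N) (LocalRing E v)) ∈
          (LemD1OfPlace.standingData E v c N J hcδ hδ hN hJh hJdet).normOne),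
        Ψ g = θ ⟨Matrix.GeneralLinearGroup.det (g : GL (Fin N) (LocalRing E v)), hg⟩) ∧
      (∀ z : (LemD1OfPlace.standingData E v c N J hcδ hδ hN hJh hJdet).normOne,
        Ψ ((LemD1OfPlace.standingData E v c N J hcδ hδ hN hJh hJdet).scalar z) = 1) ∧
      (∃ O : Set (LemD1OfPlace.standingData E v c N J hcδ hδ hN hJh hJdet).U, IsOpen O ∧ 1 ∈ O ∧ ∀ g ∈ O, Ψ g = 1) ∧
      (∃ g₀ : (LemD1OfPlace.standingData E v c N J hcδ hδ hN hJh hJdet).U, Ψ g₀ ≠ 1) ∧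
      (∀ g, Ψ g ^ N = 1) ∧ (∀ g, ‖((Ψ g : ℂˣ) : ℂ)‖ = 1) := by
  have hN0 : N ≠ 0 := by omega
  let S := LemD1OfPlace.standingData E v c N J hcδ hδ hN hJh hJdet
  -- `detN : U(V)(F_v) → E_v¹`, `Ψ = θ ∘ detN`
  let detN : S.U →* S.normOne :=
    (Matrix.GeneralLinearGroup.det.comp S.U.subtype).codRestrict S.normOne fun g => det_mem_normOne E v c hcδ hδ N J hN hJh hJdet g
  have hdetN : ∀ g : S.U, ((detN g : S.normOne) : (LocalRing E v)ˣ) = Matrix.GeneralLinearGroup.det (g : GL (Fin N) (LocalRing E v)) :=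
    fun g => rfl
  let Ψ : S.U →* ℂˣ := θ.comp detN
  have hΨ : ∀ g, Ψ g = θ (detN g) := fun g => rfl
  have hdet : ∀ z : S.normOne, detN (S.scalar z) = z ^ N := fun z => det_scalar E v c hcδ hδ N J hN hJh hJdet z
  have hΨN : ∀ g, Ψ g ^ N = 1 := fun g => by
    rw [hΨ, ← map_pow]
    exact hθN _
  refine ⟨Ψ, fun g hg => rfl, fun z => ?_, ?_, ?_, hΨN, fun g => Complex.norm_eq_one_of_pow_eq_one ?_ hN0⟩
  · rw [hΨ, hdet]
    exact hθN z
  · -- the open neighbourhood `{g : det(g)_w ∈ V}` of `1`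
    let f : S.U → w.1.adicCompletion E := fun g =>
      (((g : GL (Fin N) (LocalRing E v)) : Matrix (Fin N) (Fin N) (LocalRing E v)).map
        (Pi.evalRingHom (fun w' : PlacesOver E v => w'.1.adicCompletion E) w)).det
    have hf : ∀ g, f g =
        ((Matrix.GeneralLinearGroup.det (g : GL (Fin N) (LocalRing E v)) : (LocalRing E v)ˣ) : LocalRing E v) w := fun g => by
      rw [Matrix.GeneralLinearGroup.val_det_apply]
      change _ = (Pi.evalRingHom (fun w' : PlacesOver E v => w'.1.adicCompletion E) w)
        (((g : GL (Fin N) (LocalRing E v)) : Matrix (Fin N) (Fin N) (LocalRing E v)).det)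
      rw [RingHom.map_det]
      rfl
    have hfc : Continuous f := by
      refine Continuous.matrix_det ?_
      refine Continuous.matrix_map ?_ (continuous_apply w)
      exact Units.continuous_val.comp continuous_subtype_val
    refine ⟨f ⁻¹' V, hV.preimage hfc, ?_, fun g hg => ?_⟩
    · rw [Set.mem_preimage, hf, OneMemClass.coe_one, map_one, Units.val_one, Pi.one_apply]
      exact h1V
    · rw [Set.mem_preimage, hf] at hg
      rw [hΨ]
      exact hθV _ hg
  · -- non-triviality: `det` is onto `E_v¹`
    obtain ⟨z₀, hz₀⟩ := hθne
    obtain ⟨g₀, hg₀⟩ := LemD1IndexedNonVacuityDetCarrier.exists_mem_U_det_eq E v c hcδ hδ N J hN hJh hJdet z₀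
    refine ⟨g₀, ?_⟩
    have hdg : detN g₀ = z₀ := Subtype.ext (by rw [hdetN, hg₀])
    rw [hΨ, hdg]
    exact hz₀
  · rw [← Units.val_pow_eq_pow_val, hΨN g, Units.val_one]

/-! ## §2 The sources: a global norm-one unit (non-split `w`) — `N` even ∕ wild ∕ inert —, and the split places -/

include hcδ in
/-- **det-line carrier FROM A GLOBAL NORM-ONE UNIT, `θ` EXPOSED** — at a NON-SPLIT place `w` (`c • w = w`), every `N ≥ 2`, every
`ζ ∈ E` with `ζ · c(ζ) = 1`, `v_w(ζ − 1) ≠ 0`, `v_w(ζ^N − 1) < v_w(ζ − 1) =: γ`: the character `θ` of `E_v¹` of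
✔ `…WildCarrier.exists_character_pow_eq_one_of_level` (on the image of `E_v¹` in `E_wˣ`: `θ^N = 1`, `θ = 1` on `{v_w(x − 1) < γ}`, `θ ≠ 1`)
fed to the engine of §1 (`V = {y : v_w(y − 1) < γ}`).  Same content as ✔ `…InertCarrier.exists_carrier_character_of_norm_one`, with the
factorisation `Ψ g = θ(det g)` in the type. [cite: Liu2021, App. D §D.1 Step 3 (l. 5221)] [cite: NeukirchANT1999, Ch. II §3 Prop. (3.10)] -/
theorem exists_detLine_carrier_of_norm_one (w : PlacesOver E v) (hw : c • w.1 = w.1) (ζ : E) (hζc : ζ * c ζ = 1)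
    (hζ0 : w.1.valuation E (ζ - 1) ≠ 0) (hζN : w.1.valuation E (ζ ^ N - 1) < w.1.valuation E (ζ - 1)) :
    ∃ (Ψ : (LemD1OfPlace.standingData E v c N J hcδ hδ hN hJh hJdet).U →* ℂˣ)
      (θ : (LemD1OfPlace.standingData E v c N J hcδ hδ hN hJh hJdet).normOne →* ℂˣ),
      (∀ (g : (LemD1OfPlace.standingData E v c N J hcδ hδ hN hJh hJdet).U)
        (hg : Matrix.GeneralLinearGroup.det (g : GL (Fin N) (LocalRing E v)) ∈
          (LemD1OfPlace.standingData E v c N J hcδ hδ hN hJh hJdet).normOne),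
        Ψ g = θ ⟨Matrix.GeneralLinearGroup.det (g : GL (Fin N) (LocalRing E v)), hg⟩) ∧
      (∀ z : (LemD1OfPlace.standingData E v c N J hcδ hδ hN hJh hJdet).normOne,
        Ψ ((LemD1OfPlace.standingData E v c N J hcδ hδ hN hJh hJdet).scalar z) = 1) ∧
      (∃ O : Set (LemD1OfPlace.standingData E v c N J hcδ hδ hN hJh hJdet).U, IsOpen O ∧ 1 ∈ O ∧ ∀ g ∈ O, Ψ g = 1) ∧
      (∃ g₀ : (LemD1OfPlace.standingData E v c N J hcδ hδ hN hJh hJdet).U, Ψ g₀ ≠ 1) ∧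
      (∀ g, Ψ g ^ N = 1) ∧ (∀ g, ‖((Ψ g : ℂˣ) : ℂ)‖ = 1) := by
  have hN0 : N ≠ 0 := by omega
  let S := LemD1OfPlace.standingData E v c N J hcδ hδ hN hJh hJdet
  let prw : (LocalRing E v)ˣ →* (w.1.adicCompletion E)ˣ :=
    Units.map (Pi.evalRingHom (fun w' : PlacesOver E v => w'.1.adicCompletion E) w).toMonoidHom
  have hprw : ∀ y : (LocalRing E v)ˣ, ((prw y : (w.1.adicCompletion E)ˣ) : w.1.adicCompletion E) = (y : LocalRing E v) w :=
    fun y => rfl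
  -- the image `A` of `E_v¹` in `E_wˣ`: `w`-units
  let A : Subgroup (w.1.adicCompletion E)ˣ := S.normOne.map prw
  have hA : ∀ x ∈ A, Valued.v ((x : (w.1.adicCompletion E)ˣ) : w.1.adicCompletion E) = 1 := by
    rintro x ⟨z, hz, rfl⟩
    rw [hprw]
    exact valued_apply_eq_one_of_mem_normOne E v c hcδ hδ N J hN hJh hJdet w hw ⟨z, hz⟩
  -- the global norm-one unit `ι(ζ) ∈ E_v¹`
  have hu : IsUnit (algebraMap E (LocalRing E v) ζ) :=
    IsUnit.of_mul_eq_one (algebraMap E (LocalRing E v) (c ζ)) (by rw [← map_mul, hζc, map_one])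
  have hzn : hu.unit ∈ S.normOne := by
    rw [OscillatorStandingData.mem_normOne_iff', LemD1OfPlace.standingData_conj_apply, IsUnit.unit_spec, conjLocal_algebraMap,
      ← map_mul, hζc, map_one]
  have hζA : prw hu.unit ∈ A := Subgroup.mem_map_of_mem prw hzn
  have hcoe : ((prw hu.unit : (w.1.adicCompletion E)ˣ) : w.1.adicCompletion E) = ((ζ : E) : w.1.adicCompletion E) := by
    rw [hprw, IsUnit.unit_spec]; rfl
  have hval : Valued.v (((prw hu.unit : (w.1.adicCompletion E)ˣ) : w.1.adicCompletion E) - 1) = w.1.valuation E (ζ - 1) := by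
    rw [hcoe]
    have : ((ζ : E) : w.1.adicCompletion E) - 1 = ((ζ - 1 : E) : w.1.adicCompletion E) := by
      change algebraMap E (w.1.adicCompletion E) ζ - 1 = algebraMap E (w.1.adicCompletion E) (ζ - 1)
      rw [map_sub, map_one]
    rw [this, HeightOneSpectrum.valuedAdicCompletion_eq_valuation']
  have hvalN : Valued.v ((((prw hu.unit) ^ N : (w.1.adicCompletion E)ˣ) : w.1.adicCompletion E) - 1) =
      w.1.valuation E (ζ ^ N - 1) := by
    rw [Units.val_pow_eq_pow_val, hcoe]
    have : ((ζ : E) : w.1.adicCompletion E) ^ N - 1 = ((ζ ^ N - 1 : E) : w.1.adicCompletion E) := by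
      change algebraMap E (w.1.adicCompletion E) ζ ^ N - 1 = algebraMap E (w.1.adicCompletion E) (ζ ^ N - 1)
      rw [map_sub, map_pow, map_one]
    rw [this, HeightOneSpectrum.valuedAdicCompletion_eq_valuation']
  have hζ0' : Valued.v (((prw hu.unit : (w.1.adicCompletion E)ˣ) : w.1.adicCompletion E) - 1) ≠ 0 := by rw [hval]; exact hζ0
  have hζN' : Valued.v ((((prw hu.unit) ^ N : (w.1.adicCompletion E)ˣ) : w.1.adicCompletion E) - 1) <
      Valued.v (((prw hu.unit : (w.1.adicCompletion E)ˣ) : w.1.adicCompletion E) - 1) := by rw [hvalN, hval]; exact hζN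
  obtain ⟨θ, hθN, -, hθ1, ⟨x₀, hx₀⟩⟩ :=
    LemD1IndexedNonVacuityWildCarrier.exists_character_pow_eq_one_of_level w.1 hN0 A hA hζA hζ0' hζN'
  -- `θ' = θ ∘ (E_v¹ → A)` and the engine
  let θ' : S.normOne →* ℂˣ := θ.comp (prw.subgroupMap S.normOne)
  have hθ' : ∀ z, θ' z = θ (prw.subgroupMap S.normOne z) := fun z => rfl
  obtain ⟨z₀, rfl⟩ := MonoidHom.subgroupMap_surjective prw S.normOne x₀
  obtain ⟨Ψ, hfac, hcen, hopen, hne, hpow, hnorm⟩ :=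
    exists_detLine_carrier_of_character E v c hcδ hδ N J hN hJh hJdet w θ' (fun z => by rw [hθ', map_pow, map_pow]; exact hθN _)
      {y | Valued.v (y - 1) < Valued.v (((prw hu.unit : (w.1.adicCompletion E)ˣ) : w.1.adicCompletion E) - 1)}
      (isOpen_setOf_valued_sub_one_lt w.1 _) (by rw [Set.mem_setOf_eq, sub_self, map_zero]; exact zero_lt_iff.2 hζ0')
      (fun z hz => by rw [hθ']; exact hθ1 _ hz) ⟨z₀, hx₀⟩
  exact ⟨Ψ, θ', hfac, hcen, hopen, hne, hpow, hnorm⟩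

include hcδ in
/-- **`N` EVEN: a det-line carrier at EVERY NON-SPLIT place** (ANY quadratic `E/F`, ANY hermitian `J`, every even `N ≥ 2`, the place
dyadic, ramified or not, NO tameness): §2 with `ζ = −1` — `(−1) · c(−1) = 1`, `v_w(−1 − 1) = v_w(−2) ≠ 0`, `v_w((−1)^N − 1) = v_w(0) = 0 <
v_w(−2)`.  So the hypothesis `Odd N` of ✔ `…RamifiedConverse` ∕ `…TameSynthesis` (and `gcd(N, q_v + 1) = 1` of ✔ `…InertConverse`, which
fails for even `N` at odd `q_v`) is NECESSARY: see §3. [cite: Liu2021, App. D §D.1 Step 3 (l. 5221)] [cite: NeukirchANT1999, Ch. II §3 Prop. (3.10)] -/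
theorem exists_detLine_carrier_of_even (w : PlacesOver E v) (hw : c • w.1 = w.1) (hNe : Even N) :
    ∃ (Ψ : (LemD1OfPlace.standingData E v c N J hcδ hδ hN hJh hJdet).U →* ℂˣ)
      (θ : (LemD1OfPlace.standingData E v c N J hcδ hδ hN hJh hJdet).normOne →* ℂˣ),
      (∀ (g : (LemD1OfPlace.standingData E v c N J hcδ hδ hN hJh hJdet).U)
        (hg : Matrix.GeneralLinearGroup.det (g : GL (Fin N) (LocalRing E v)) ∈
          (LemD1OfPlace.standingData E v c N J hcδ hδ hN hJh hJdet).normOne),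
        Ψ g = θ ⟨Matrix.GeneralLinearGroup.det (g : GL (Fin N) (LocalRing E v)), hg⟩) ∧
      (∀ z : (LemD1OfPlace.standingData E v c N J hcδ hδ hN hJh hJdet).normOne,
        Ψ ((LemD1OfPlace.standingData E v c N J hcδ hδ hN hJh hJdet).scalar z) = 1) ∧
      (∃ O : Set (LemD1OfPlace.standingData E v c N J hcδ hδ hN hJh hJdet).U, IsOpen O ∧ 1 ∈ O ∧ ∀ g ∈ O, Ψ g = 1) ∧
      (∃ g₀ : (LemD1OfPlace.standingData E v c N J hcδ hδ hN hJh hJdet).U, Ψ g₀ ≠ 1) ∧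
      (∀ g, Ψ g ^ N = 1) ∧ (∀ g, ‖((Ψ g : ℂˣ) : ℂ)‖ = 1) := by
  have h2 : w.1.valuation E (-1 - 1) ≠ 0 := (Valuation.ne_zero_iff _).2 (by norm_num)
  exact exists_detLine_carrier_of_norm_one E v c hcδ hδ N J hN hJh hJdet w hw (-1) (by rw [map_neg, map_one]; ring) h2
    (by rw [hNe.neg_one_pow, sub_self, map_zero]; exact zero_lt_iff.2 h2)

include hcδ in
/-- **WILD places: a det-line carrier at every NON-SPLIT `w` with `v_w(N) < 1`** (every `N ≥ 2`, ANY `E/F`): §2 with the global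
principal norm-one unit `a = (1 + u)/(1 − u)` of ✔ `…WildCarrier.exists_mul_conj_eq_one_valuation_sub_one_lt` (`0 < ord_w(a − 1) < ∞`;
`v_w(a^N − 1) < v_w(a − 1)` by ✔ `…WildCarrier.valued_pow_sub_one_lt`).  Same content as ✔ `…WildCarrier.exists_wild_carrier_character`, `θ`
exposed. [cite: Liu2021, App. D §D.1 Step 3 (l. 5221)] [cite: NeukirchANT1999, Ch. II §3 Prop. (3.10)] -/
theorem exists_detLine_carrier_of_wild (w : PlacesOver E v) (hw : c • w.1 = w.1) (hwN : Valued.v ((N : w.1.adicCompletion E)) < 1) :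
    ∃ (Ψ : (LemD1OfPlace.standingData E v c N J hcδ hδ hN hJh hJdet).U →* ℂˣ)
      (θ : (LemD1OfPlace.standingData E v c N J hcδ hδ hN hJh hJdet).normOne →* ℂˣ),
      (∀ (g : (LemD1OfPlace.standingData E v c N J hcδ hδ hN hJh hJdet).U)
        (hg : Matrix.GeneralLinearGroup.det (g : GL (Fin N) (LocalRing E v)) ∈
          (LemD1OfPlace.standingData E v c N J hcδ hδ hN hJh hJdet).normOne),
        Ψ g = θ ⟨Matrix.GeneralLinearGroup.det (g : GL (Fin N) (LocalRing E v)), hg⟩) ∧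
      (∀ z : (LemD1OfPlace.standingData E v c N J hcδ hδ hN hJh hJdet).normOne,
        Ψ ((LemD1OfPlace.standingData E v c N J hcδ hδ hN hJh hJdet).scalar z) = 1) ∧
      (∃ O : Set (LemD1OfPlace.standingData E v c N J hcδ hδ hN hJh hJdet).U, IsOpen O ∧ 1 ∈ O ∧ ∀ g ∈ O, Ψ g = 1) ∧
      (∃ g₀ : (LemD1OfPlace.standingData E v c N J hcδ hδ hN hJh hJdet).U, Ψ g₀ ≠ 1) ∧
      (∀ g, Ψ g ^ N = 1) ∧ (∀ g, ‖((Ψ g : ℂˣ) : ℂ)‖ = 1) := by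
  obtain ⟨a, hac, ha0, ha1⟩ := LemD1IndexedNonVacuityWildCarrier.exists_mul_conj_eq_one_valuation_sub_one_lt E v c hcδ hδ w
  exact exists_detLine_carrier_of_norm_one E v c hcδ hδ N J hN hJh hJdet w hw a hac ha0 (valuation_pow_sub_one_lt w.1 hwN ha0 ha1)

include hcδ in
/-- **INERT places with `gcd(N, q_v + 1) > 1`: a det-line carrier** (`v` unramified in `E`, `c • w = w`, `N ≥ 2` not coprime to `q_v + 1`,
ANY `E/F`): §2 with the inert torsion witness `ζ = u / c(u)` of ✔ `…InertFrobenius.exists_norm_one_inert_witness_of_not_coprime`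
(`v_w(ζ − 1) = 1`, `v_w(ζ^N − 1) < 1`).  Same content as ✔ `…InertCarrier.exists_inert_carrier_character`, `θ` exposed.
[cite: Liu2021, App. D §D.1 Step 3 (l. 5221)] [cite: NeukirchANT1999, Ch. I §9 Exercise 2] -/
theorem exists_detLine_carrier_of_isUnramifiedIn (hv : Algebra.IsUnramifiedIn (𝓞 E) v.asIdeal) (w : PlacesOver E v)
    (hw : c • w.1 = w.1) (hNq : ¬ Nat.Coprime N (Nat.card (𝓞 F ⧸ v.asIdeal) + 1)) :
    ∃ (Ψ : (LemD1OfPlace.standingData E v c N J hcδ hδ hN hJh hJdet).U →* ℂˣ)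
      (θ : (LemD1OfPlace.standingData E v c N J hcδ hδ hN hJh hJdet).normOne →* ℂˣ),
      (∀ (g : (LemD1OfPlace.standingData E v c N J hcδ hδ hN hJh hJdet).U)
        (hg : Matrix.GeneralLinearGroup.det (g : GL (Fin N) (LocalRing E v)) ∈
          (LemD1OfPlace.standingData E v c N J hcδ hδ hN hJh hJdet).normOne),
        Ψ g = θ ⟨Matrix.GeneralLinearGroup.det (g : GL (Fin N) (LocalRing E v)), hg⟩) ∧
      (∀ z : (LemD1OfPlace.standingData E v c N J hcδ hδ hN hJh hJdet).normOne,
        Ψ ((LemD1OfPlace.standingData E v c N J hcδ hδ hN hJh hJdet).scalar z) = 1) ∧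
      (∃ O : Set (LemD1OfPlace.standingData E v c N J hcδ hδ hN hJh hJdet).U, IsOpen O ∧ 1 ∈ O ∧ ∀ g ∈ O, Ψ g = 1) ∧
      (∃ g₀ : (LemD1OfPlace.standingData E v c N J hcδ hδ hN hJh hJdet).U, Ψ g₀ ≠ 1) ∧
      (∀ g, Ψ g ^ N = 1) ∧ (∀ g, ‖((Ψ g : ℂˣ) : ℂ)‖ = 1) := by
  obtain ⟨ζ, hζc, -, hζ1, hζN⟩ := LemD1IndexedNonVacuityInertFrobenius.exists_norm_one_inert_witness_of_not_coprime E c v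
    (hc_of_delta E c hcδ hδ) hv w hw hNq
  exact exists_detLine_carrier_of_norm_one E v c hcδ hδ N J hN hJh hJdet w hw ζ hζc (by rw [hζ1]; exact one_ne_zero)
    (by rw [hζ1]; exact hζN)

include hcδ in
/-- **… the same in the `e(w|v)`-vocabulary**: `c • w = w`, `e(w|v) = 1` (inert; ✔ `…TameSynthesis.isUnramifiedIn_of_ramificationIdx'_eq_one`)
and `gcd(N, q_v + 1) > 1`. [cite: Liu2021, App. D §D.1 Step 3 (l. 5221)] [cite: NeukirchANT1999, Ch. I §9 Exercise 2] -/
theorem exists_detLine_carrier_of_inert (w : PlacesOver E v) (hw : c • w.1 = w.1)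
    (he : v.asIdeal.ramificationIdx' w.1.asIdeal = 1) (hNq : ¬ Nat.Coprime N (Nat.card (𝓞 F ⧸ v.asIdeal) + 1)) :
    ∃ (Ψ : (LemD1OfPlace.standingData E v c N J hcδ hδ hN hJh hJdet).U →* ℂˣ)
      (θ : (LemD1OfPlace.standingData E v c N J hcδ hδ hN hJh hJdet).normOne →* ℂˣ),
      (∀ (g : (LemD1OfPlace.standingData E v c N J hcδ hδ hN hJh hJdet).U)
        (hg : Matrix.GeneralLinearGroup.det (g : GL (Fin N) (LocalRing E v)) ∈
          (LemD1OfPlace.standingData E v c N J hcδ hδ hN hJh hJdet).normOne),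
        Ψ g = θ ⟨Matrix.GeneralLinearGroup.det (g : GL (Fin N) (LocalRing E v)), hg⟩) ∧
      (∀ z : (LemD1OfPlace.standingData E v c N J hcδ hδ hN hJh hJdet).normOne,
        Ψ ((LemD1OfPlace.standingData E v c N J hcδ hδ hN hJh hJdet).scalar z) = 1) ∧
      (∃ O : Set (LemD1OfPlace.standingData E v c N J hcδ hδ hN hJh hJdet).U, IsOpen O ∧ 1 ∈ O ∧ ∀ g ∈ O, Ψ g = 1) ∧
      (∃ g₀ : (LemD1OfPlace.standingData E v c N J hcδ hδ hN hJh hJdet).U, Ψ g₀ ≠ 1) ∧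
      (∀ g, Ψ g ^ N = 1) ∧ (∀ g, ‖((Ψ g : ℂˣ) : ℂ)‖ = 1) :=
  exists_detLine_carrier_of_isUnramifiedIn E v c hcδ hδ N J hN hJh hJdet
    (LemD1IndexedNonVacuityTameSynthesis.isUnramifiedIn_of_ramificationIdx'_eq_one E c v (hc_of_delta E c hcδ hδ) w hw he) w hw hNq

include hcδ in
/-- **SPLIT places: the det carrier `Ψ = ν_w ∘ det_w`, `θ = ν_w ∘ pr_w` EXPOSED** (`c • w ≠ w`, every `N ≥ 2`, ANY `E/F`): `ν_w = ζ_N^{ord_w}`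
kills the units of valuation `1` (so `V = {y : v_w(y) = 1}`) and the `N`-th powers, and `ν_w(ι(a)_w) ≠ 1` at the global norm-one element
`a = b / c(b)` of `w`-order `1` of ✔ `…DetCarrier.exists_mul_conj_eq_one_valuation_eq_of_split`.  Same content as
✔ `…DetCarrier.exists_det_carrier_character_of_split`, `θ` exposed. [cite: Liu2021, App. D §D.1 Step 3 (l. 5221)] [cite: Mok2014, §1 Notation p. 5] -/
theorem exists_detLine_carrier_of_split (w : PlacesOver E v) (hw : c • w.1 ≠ w.1) :
    ∃ (Ψ : (LemD1OfPlace.standingData E v c N J hcδ hδ hN hJh hJdet).U →* ℂˣ)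
      (θ : (LemD1OfPlace.standingData E v c N J hcδ hδ hN hJh hJdet).normOne →* ℂˣ),
      (∀ (g : (LemD1OfPlace.standingData E v c N J hcδ hδ hN hJh hJdet).U)
        (hg : Matrix.GeneralLinearGroup.det (g : GL (Fin N) (LocalRing E v)) ∈
          (LemD1OfPlace.standingData E v c N J hcδ hδ hN hJh hJdet).normOne),
        Ψ g = θ ⟨Matrix.GeneralLinearGroup.det (g : GL (Fin N) (LocalRing E v)), hg⟩) ∧
      (∀ z : (LemD1OfPlace.standingData E v c N J hcδ hδ hN hJh hJdet).normOne,
        Ψ ((LemD1OfPlace.standingData E v c N J hcδ hδ hN hJh hJdet).scalar z) = 1) ∧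
      (∃ O : Set (LemD1OfPlace.standingData E v c N J hcδ hδ hN hJh hJdet).U, IsOpen O ∧ 1 ∈ O ∧ ∀ g ∈ O, Ψ g = 1) ∧
      (∃ g₀ : (LemD1OfPlace.standingData E v c N J hcδ hδ hN hJh hJdet).U, Ψ g₀ ≠ 1) ∧
      (∀ g, Ψ g ^ N = 1) ∧ (∀ g, ‖((Ψ g : ℂˣ) : ℂ)‖ = 1) := by
  let S := LemD1OfPlace.standingData E v c N J hcδ hδ hN hJh hJdet
  obtain ⟨ν, hν1, hνN, hνϖ⟩ := exists_unramified_character w.1 hN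
  let prw : (LocalRing E v)ˣ →* (w.1.adicCompletion E)ˣ :=
    Units.map (Pi.evalRingHom (fun w' : PlacesOver E v => w'.1.adicCompletion E) w).toMonoidHom
  have hprw : ∀ y : (LocalRing E v)ˣ, ((prw y : (w.1.adicCompletion E)ˣ) : w.1.adicCompletion E) = (y : LocalRing E v) w :=
    fun y => rfl
  let θ : S.normOne →* ℂˣ := (ν.comp prw).comp S.normOne.subtype
  have hθ : ∀ z : S.normOne, θ z = ν (prw (z : (LocalRing E v)ˣ)) := fun z => rfl
  -- the global norm-one element of `w`-order `1`
  obtain ⟨a, ha, haw⟩ := LemD1IndexedNonVacuityDetCarrier.exists_mul_conj_eq_one_valuation_eq_of_split E v c hcδ hδ w hw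
  have hu : IsUnit (algebraMap E (LocalRing E v) a) :=
    IsUnit.of_mul_eq_one (algebraMap E (LocalRing E v) (c a)) (by rw [← map_mul, ha, map_one])
  have hzn : hu.unit ∈ S.normOne := by
    rw [OscillatorStandingData.mem_normOne_iff', LemD1OfPlace.standingData_conj_apply, IsUnit.unit_spec, conjLocal_algebraMap,
      ← map_mul, ha, map_one]
  obtain ⟨Ψ, hfac, hcen, hopen, hne, hpow, hnorm⟩ :=
    exists_detLine_carrier_of_character E v c hcδ hδ N J hN hJh hJdet w θ
      (fun z => by rw [hθ, SubgroupClass.coe_pow, map_pow, map_pow, hνN]) {y | Valued.v y = 1} (isOpen_setOf_valued_eq_one w.1)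
      (by rw [Set.mem_setOf_eq, map_one]) (fun z hz => by rw [hθ]; exact hν1 _ hz)
      ⟨⟨hu.unit, hzn⟩, by
        rw [hθ]
        refine hνϖ _ ?_
        rw [hprw]
        change Valued.v ((((hu.unit : (LocalRing E v)ˣ) : LocalRing E v)) w) = _
        rw [IsUnit.unit_spec]
        change Valued.v ((a : E) : w.1.adicCompletion E) = _
        rw [HeightOneSpectrum.valuedAdicCompletion_eq_valuation', haw]⟩
  exact ⟨Ψ, θ, hfac, hcen, hopen, hne, hpow, hnorm⟩

/-! ## §3 `N`-divisibility of `E_v¹` versus det-line carriers; the converses' `Odd N` is NECESSARY -/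

include hcδ in
/-- **a det-line carrier with trivial central character FORBIDS `N`-divisibility of `E_v¹`** (any place, any `N ≥ 2`): if `Ψ = θ ∘ det`
is trivial on the centre then `θ` kills `(E_v¹)^N` (`det(z · 1_N) = z^N`); if moreover every `z ∈ E_v¹` is an `N`-th power then `θ = 1` and
`Ψ = 1` — the abstract last step of ✔ `…InertConverse` ∕ `…RamifiedConverse`. [cite: Liu2021, App. D §D.1 Step 3 (l. 5221)]
[cite: NeukirchANT1999, Ch. II §5 Prop. (5.3)] -/
theorem eq_one_of_factors_through_det_of_forall_exists_pow_eq
    (hdiv : ∀ z : (LemD1OfPlace.standingData E v c N J hcδ hδ hN hJh hJdet).normOne,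
      ∃ y : (LemD1OfPlace.standingData E v c N J hcδ hδ hN hJh hJdet).normOne, y ^ N = z)
    (Ψ : (LemD1OfPlace.standingData E v c N J hcδ hδ hN hJh hJdet).U →* ℂˣ)
    (θ : (LemD1OfPlace.standingData E v c N J hcδ hδ hN hJh hJdet).normOne →* ℂˣ)
    (hΨ : ∀ (g : (LemD1OfPlace.standingData E v c N J hcδ hδ hN hJh hJdet).U)
      (hg : Matrix.GeneralLinearGroup.det (g : GL (Fin N) (LocalRing E v)) ∈
        (LemD1OfPlace.standingData E v c N J hcδ hδ hN hJh hJdet).normOne),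
      Ψ g = θ ⟨Matrix.GeneralLinearGroup.det (g : GL (Fin N) (LocalRing E v)), hg⟩)
    (hcen : ∀ z : (LemD1OfPlace.standingData E v c N J hcδ hδ hN hJh hJdet).normOne,
      Ψ ((LemD1OfPlace.standingData E v c N J hcδ hδ hN hJh hJdet).scalar z) = 1) :
    Ψ = 1 := by
  let S := LemD1OfPlace.standingData E v c N J hcδ hδ hN hJh hJdet
  have hθ : ∀ z : S.normOne, θ (z ^ N) = 1 := fun z => by
    rw [← det_scalar E v c hcδ hδ N J hN hJh hJdet z, ← hΨ (S.scalar z) (det_mem_normOne E v c hcδ hδ N J hN hJh hJdet (S.scalar z))]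
    exact hcen z
  ext g
  rw [hΨ g (det_mem_normOne E v c hcδ hδ N J hN hJh hJdet g), MonoidHom.one_apply]
  obtain ⟨y, hy⟩ := hdiv ⟨Matrix.GeneralLinearGroup.det (g : GL (Fin N) (LocalRing E v)), det_mem_normOne E v c hcδ hδ N J hN hJh hJdet g⟩
  rw [← hy, hθ y]

include hcδ in
/-- **… so wherever a det-line carrier with trivial central character exists, `E_v¹ ≠ (E_v¹)^N`.**
[cite: Liu2021, App. D §D.1 Step 3 (l. 5221)] [cite: NeukirchANT1999, Ch. II §5 Prop. (5.3)] -/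
theorem not_forall_exists_pow_eq_of_detLine_carrier
    (Ψ : (LemD1OfPlace.standingData E v c N J hcδ hδ hN hJh hJdet).U →* ℂˣ)
    (θ : (LemD1OfPlace.standingData E v c N J hcδ hδ hN hJh hJdet).normOne →* ℂˣ)
    (hΨ : ∀ (g : (LemD1OfPlace.standingData E v c N J hcδ hδ hN hJh hJdet).U)
      (hg : Matrix.GeneralLinearGroup.det (g : GL (Fin N) (LocalRing E v)) ∈
        (LemD1OfPlace.standingData E v c N J hcδ hδ hN hJh hJdet).normOne),
      Ψ g = θ ⟨Matrix.GeneralLinearGroup.det (g : GL (Fin N) (LocalRing E v)), hg⟩)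
    (hcen : ∀ z : (LemD1OfPlace.standingData E v c N J hcδ hδ hN hJh hJdet).normOne,
      Ψ ((LemD1OfPlace.standingData E v c N J hcδ hδ hN hJh hJdet).scalar z) = 1)
    (hne : ∃ g₀ : (LemD1OfPlace.standingData E v c N J hcδ hδ hN hJh hJdet).U, Ψ g₀ ≠ 1) :
    ¬ ∀ z : (LemD1OfPlace.standingData E v c N J hcδ hδ hN hJh hJdet).normOne,
        ∃ y : (LemD1OfPlace.standingData E v c N J hcδ hδ hN hJh hJdet).normOne, y ^ N = z := by
  intro hdiv
  obtain ⟨g₀, hg₀⟩ := hne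
  exact hg₀ (by rw [eq_one_of_factors_through_det_of_forall_exists_pow_eq E v c hcδ hδ N J hN hJh hJdet hdiv Ψ θ hΨ hcen,
    MonoidHom.one_apply])

include hcδ in
/-- **`N` EVEN, EVERY NON-SPLIT place: «every det-factoring centre-trivial character of `U(V)(F_v)` is trivial» is FALSE** — the
conclusion of ✔ `…InertConverse.eq_one_of_factors_through_det`, ✔ `…RamifiedConverse.eq_one_of_factors_through_det_of_ramified` and
✔ `…TameSynthesis.eq_one_of_factors_through_det_of_nonsplit` fails for every even `N ≥ 2` at every non-split place of every quadratic `E/F`: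
their hypotheses `gcd(N, q_v + 1) = 1` ∕ `Odd N` are load-bearing. [cite: Liu2021, App. D §D.1 Step 3 (l. 5221) and Lemma D.1 (3) (l. 5233)] -/
theorem not_forall_eq_one_of_factors_through_det_of_even (w : PlacesOver E v) (hw : c • w.1 = w.1) (hNe : Even N) :
    ¬ ∀ (Ψ : (LemD1OfPlace.standingData E v c N J hcδ hδ hN hJh hJdet).U →* ℂˣ)
        (θ : (LemD1OfPlace.standingData E v c N J hcδ hδ hN hJh hJdet).normOne →* ℂˣ),
        (∀ (g : (LemD1OfPlace.standingData E v c N J hcδ hδ hN hJh hJdet).U)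
          (hg : Matrix.GeneralLinearGroup.det (g : GL (Fin N) (LocalRing E v)) ∈
            (LemD1OfPlace.standingData E v c N J hcδ hδ hN hJh hJdet).normOne),
          Ψ g = θ ⟨Matrix.GeneralLinearGroup.det (g : GL (Fin N) (LocalRing E v)), hg⟩) →
        (∀ z : (LemD1OfPlace.standingData E v c N J hcδ hδ hN hJh hJdet).normOne,
          Ψ ((LemD1OfPlace.standingData E v c N J hcδ hδ hN hJh hJdet).scalar z) = 1) →
        Ψ = 1 := by
  intro h
  obtain ⟨Ψ, θ, hfac, hcen, -, ⟨g₀, hg₀⟩, -, -⟩ := exists_detLine_carrier_of_even E v c hcδ hδ N J hN hJh hJdet w hw hNe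
  exact hg₀ (by rw [h Ψ θ hfac hcen, MonoidHom.one_apply])

include hcδ in
/-- **`N` EVEN, EVERY NON-SPLIT place: `E_v¹` is NOT `N`-divisible** (`(E_v¹ : (E_v¹)^N) > 1`; contrast ✔ `…InertConverse.exists_pow_eq_of_mem_normOne`
and ✔ `…RamifiedConverse.exists_pow_eq_of_mem_normOne_of_ramified` for `N` odd at the tame places).  NB: `−1` itself MAY be an `N`-th power in
`E_v¹` (e.g. `−1 = i²` in `ℚ₃(i)¹`); the obstruction is the even order of the torsion of `E_w¹`. [cite: NeukirchANT1999, Ch. II §5 Prop. (5.3)]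
[cite: Liu2021, App. D §D.1 Step 3 (l. 5221)] -/
theorem not_forall_exists_pow_eq_of_even (w : PlacesOver E v) (hw : c • w.1 = w.1) (hNe : Even N) :
    ¬ ∀ z : (LemD1OfPlace.standingData E v c N J hcδ hδ hN hJh hJdet).normOne,
        ∃ y : (LemD1OfPlace.standingData E v c N J hcδ hδ hN hJh hJdet).normOne, y ^ N = z := by
  obtain ⟨Ψ, θ, hfac, hcen, -, hne, -, -⟩ := exists_detLine_carrier_of_even E v c hcδ hδ N J hN hJh hJdet w hw hNe
  exact not_forall_exists_pow_eq_of_detLine_carrier E v c hcδ hδ N J hN hJh hJdet Ψ θ hfac hcen hne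

include hcδ in
/-- **`E_v¹` is NOT `N`-divisible at a SPLIT place** (every `N ≥ 2`; `E_v¹ ≅ E_wˣ` has the quotient `ℤ` by `ord_w`).
[cite: NeukirchANT1999, Ch. II §5 Prop. (5.3)] [cite: CasselsFrohlichANT1967, Ch. II §10] -/
theorem not_forall_exists_pow_eq_of_split (w : PlacesOver E v) (hw : c • w.1 ≠ w.1) :
    ¬ ∀ z : (LemD1OfPlace.standingData E v c N J hcδ hδ hN hJh hJdet).normOne,
        ∃ y : (LemD1OfPlace.standingData E v c N J hcδ hδ hN hJh hJdet).normOne, y ^ N = z := by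
  obtain ⟨Ψ, θ, hfac, hcen, -, hne, -, -⟩ := exists_detLine_carrier_of_split E v c hcδ hδ N J hN hJh hJdet w hw
  exact not_forall_exists_pow_eq_of_detLine_carrier E v c hcδ hδ N J hN hJh hJdet Ψ θ hfac hcen hne

include hcδ in
/-- **`E_v¹` is NOT `N`-divisible at a non-split WILD place** (`v_w(N) < 1`, every `N ≥ 2`). [cite: NeukirchANT1999, Ch. II §3 Prop. (3.10) and §5 Prop. (5.3)] -/
theorem not_forall_exists_pow_eq_of_wild (w : PlacesOver E v) (hw : c • w.1 = w.1) (hwN : Valued.v ((N : w.1.adicCompletion E)) < 1) :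
    ¬ ∀ z : (LemD1OfPlace.standingData E v c N J hcδ hδ hN hJh hJdet).normOne,
        ∃ y : (LemD1OfPlace.standingData E v c N J hcδ hδ hN hJh hJdet).normOne, y ^ N = z := by
  obtain ⟨Ψ, θ, hfac, hcen, -, hne, -, -⟩ := exists_detLine_carrier_of_wild E v c hcδ hδ N J hN hJh hJdet w hw hwN
  exact not_forall_exists_pow_eq_of_detLine_carrier E v c hcδ hδ N J hN hJh hJdet Ψ θ hfac hcen hne

include hcδ in
/-- **`E_v¹` is NOT `N`-divisible at an INERT place with `gcd(N, q_v + 1) > 1`** (`e(w|v) = 1`; the residue norm-one group `κ(w)¹` has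
`q_v + 1` elements, ✔ `…InertFrobenius.card_residue_pow_card_succ_eq_one`). [cite: NeukirchANT1999, Ch. I §9 Exercise 2 and Ch. II §5 Prop. (5.3)] -/
theorem not_forall_exists_pow_eq_of_inert (w : PlacesOver E v) (hw : c • w.1 = w.1)
    (he : v.asIdeal.ramificationIdx' w.1.asIdeal = 1) (hNq : ¬ Nat.Coprime N (Nat.card (𝓞 F ⧸ v.asIdeal) + 1)) :
    ¬ ∀ z : (LemD1OfPlace.standingData E v c N J hcδ hδ hN hJh hJdet).normOne,
        ∃ y : (LemD1OfPlace.standingData E v c N J hcδ hδ hN hJh hJdet).normOne, y ^ N = z := by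
  obtain ⟨Ψ, θ, hfac, hcen, -, hne, -, -⟩ := exists_detLine_carrier_of_inert E v c hcδ hδ N J hN hJh hJdet w hw he hNq
  exact not_forall_exists_pow_eq_of_detLine_carrier E v c hcδ hδ N J hN hJh hJdet Ψ θ hfac hcen hne

end PlaceModel

/-! ## §4 The CM rows: `L` CM, `F = L⁺`, `c` = complex conjugation -/

section CM

open Literature.NumberTheory.GelbartRogawski1991.UnitaryDualPair (imagUnit complexConj_imagUnit imagUnit_ne_zero)

variable (L : Type) [Field L] [NumberField L] [IsCMField L]

local notation3 "cc" => (IsCMField.complexConj L)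
local notation3 "L⁺" => (↥(maximalRealSubfield L))

variable (v : HeightOneSpectrum (𝓞 (maximalRealSubfield L))) (N : ℕ) (J : Matrix (Fin N) (Fin N) L) (hN : 2 ≤ N)
  (hJh : (J.map (IsCMField.complexConj L))ᵀ = J) (hJdet : J.det ≠ 0)

/-- **CM rows, `N` EVEN: at every non-split place `w ∣ v` of `L` (`\bar w = w`; `v` ramified in `L`, dyadic, or not) the rows' place
model of rank `N` carries a det-line character `Ψ = θ ∘ det` of `U(V)(L⁺_v)` trivial on the centre and non-trivial.**
[cite: Liu2021, App. D §D.1 Step 3 (l. 5221) and Lemma D.1 (3) (l. 5233)] [cite: NeukirchANT1999, Ch. II §3 Prop. (3.10)] -/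
theorem exists_detLine_carrier_of_isCMField_of_even (w : PlacesOver L v) (hw : cc • w.1 = w.1) (hNe : Even N) :
    ∃ (Ψ : (LemD1OfPlace.standingData L v cc N J (complexConj_imagUnit L) (imagUnit_ne_zero L) hN hJh hJdet).U →* ℂˣ)
      (θ : (LemD1OfPlace.standingData L v cc N J (complexConj_imagUnit L) (imagUnit_ne_zero L) hN hJh hJdet).normOne →* ℂˣ),
      (∀ (g : (LemD1OfPlace.standingData L v cc N J (complexConj_imagUnit L) (imagUnit_ne_zero L) hN hJh hJdet).U)
        (hg : Matrix.GeneralLinearGroup.det (g : GL (Fin N) (LocalRing L v)) ∈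
          (LemD1OfPlace.standingData L v cc N J (complexConj_imagUnit L) (imagUnit_ne_zero L) hN hJh hJdet).normOne),
        Ψ g = θ ⟨Matrix.GeneralLinearGroup.det (g : GL (Fin N) (LocalRing L v)), hg⟩) ∧
      (∀ z : (LemD1OfPlace.standingData L v cc N J (complexConj_imagUnit L) (imagUnit_ne_zero L) hN hJh hJdet).normOne,
        Ψ ((LemD1OfPlace.standingData L v cc N J (complexConj_imagUnit L) (imagUnit_ne_zero L) hN hJh hJdet).scalar z) = 1) ∧
      (∃ O : Set (LemD1OfPlace.standingData L v cc N J (complexConj_imagUnit L) (imagUnit_ne_zero L) hN hJh hJdet).U,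
        IsOpen O ∧ 1 ∈ O ∧ ∀ g ∈ O, Ψ g = 1) ∧
      (∃ g₀ : (LemD1OfPlace.standingData L v cc N J (complexConj_imagUnit L) (imagUnit_ne_zero L) hN hJh hJdet).U, Ψ g₀ ≠ 1) ∧
      (∀ g, Ψ g ^ N = 1) ∧ (∀ g, ‖((Ψ g : ℂˣ) : ℂ)‖ = 1) :=
  exists_detLine_carrier_of_even L v cc (complexConj_imagUnit L) (imagUnit_ne_zero L) N J hN hJh hJdet w hw hNe

/-- **CM rows, `N` EVEN: «no det-line carrier» FAILS at every non-split place of `L`** — the `Odd N` of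
✔ `…TameSynthesis.eq_one_of_factors_through_det_of_isCMField_of_nonsplit` is necessary. [cite: Liu2021, App. D Lemma D.1 (3) (l. 5233)]
[cite: NeukirchANT1999, Ch. II §3 Prop. (3.10)] -/
theorem not_forall_eq_one_of_factors_through_det_of_isCMField_of_even (w : PlacesOver L v) (hw : cc • w.1 = w.1) (hNe : Even N) :
    ¬ ∀ (Ψ : (LemD1OfPlace.standingData L v cc N J (complexConj_imagUnit L) (imagUnit_ne_zero L) hN hJh hJdet).U →* ℂˣ)
        (θ : (LemD1OfPlace.standingData L v cc N J (complexConj_imagUnit L) (imagUnit_ne_zero L) hN hJh hJdet).normOne →* ℂˣ),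
        (∀ (g : (LemD1OfPlace.standingData L v cc N J (complexConj_imagUnit L) (imagUnit_ne_zero L) hN hJh hJdet).U)
          (hg : Matrix.GeneralLinearGroup.det (g : GL (Fin N) (LocalRing L v)) ∈
            (LemD1OfPlace.standingData L v cc N J (complexConj_imagUnit L) (imagUnit_ne_zero L) hN hJh hJdet).normOne),
          Ψ g = θ ⟨Matrix.GeneralLinearGroup.det (g : GL (Fin N) (LocalRing L v)), hg⟩) →
        (∀ z : (LemD1OfPlace.standingData L v cc N J (complexConj_imagUnit L) (imagUnit_ne_zero L) hN hJh hJdet).normOne,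
          Ψ ((LemD1OfPlace.standingData L v cc N J (complexConj_imagUnit L) (imagUnit_ne_zero L) hN hJh hJdet).scalar z) = 1) →
        Ψ = 1 :=
  not_forall_eq_one_of_factors_through_det_of_even L v cc (complexConj_imagUnit L) (imagUnit_ne_zero L) N J hN hJh hJdet w hw hNe

/-- **CM rows, `N` EVEN: `E_v¹` of the rows' standing data is NOT `N`-divisible at any non-split place of `L`.**
[cite: NeukirchANT1999, Ch. II §5 Prop. (5.3)] [cite: Liu2021, App. D §D.1 Step 3 (l. 5221)] -/
theorem not_forall_exists_pow_eq_of_isCMField_of_even (w : PlacesOver L v) (hw : cc • w.1 = w.1) (hNe : Even N) :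
    ¬ ∀ z : (LemD1OfPlace.standingData L v cc N J (complexConj_imagUnit L) (imagUnit_ne_zero L) hN hJh hJdet).normOne,
        ∃ y : (LemD1OfPlace.standingData L v cc N J (complexConj_imagUnit L) (imagUnit_ne_zero L) hN hJh hJdet).normOne, y ^ N = z :=
  not_forall_exists_pow_eq_of_even L v cc (complexConj_imagUnit L) (imagUnit_ne_zero L) N J hN hJh hJdet w hw hNe

end CM

end Literature.NumberTheory.Automorphic.Liu2021.LemD1IndexedNonVacuityDetLineCarriers

end
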